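import Mathlib
import Summits.CriticalPhenomena.SAWScalingLimit.Theses.SAWDefectDecoherence
import Summits.CriticalPhenomena.SAWScalingLimit.Theorems.ObservableToSLE.Negative.Identification
import Summits.CriticalPhenomena.SAWScalingLimit.Theorems.SAWDefectDecoherenceObservableToSLERGateDecomposition
import Summits.CriticalPhenomena.SAWScalingLimit.Theorems.SAWDefectDecoherenceObservableToSLERNestedLinkDefs
import Summits.CriticalPhenomena.SAWScalingLimit.Theorems.SAWDefectDecoherenceObservableToSLERNestedTransferProductCells
import Summits.CriticalPhenomena.SAWScalingLimit.Theorems.SAWDefectDecoherenceObservableToSLERGateTransferPerCell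

/-!
# The sequential reduction `CarvedSeqIdentification → MidTightN → CarvedToSLEN`

Stub `stub_seqReduction` (stub 5c of reshape r5) of the line `bridge-gate-renewal` for the crux
`Summit.CriticalPhenomena.SAWScalingLimit.Theses.SAWDefectDecoherence.ObservableToSLER`
(item `stmt-CriticalPhenomena-14005`).  Stub 5 of r3/r4 (identification of the carved middle laws,
UNIFORMLY over tame anchored nested families) was split in r5 into the research atom
`CarvedSeqIdentification` (CSI: identification CELL-WISE along a sequence of meshes `δ_k → 0⁺`,
tightness of the carved curve laws GIVEN), the averaged middle-piece tightness `MidTightN`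
(landed, `…MidTightN.lean`) and the SOFT REDUCTION proved here: CSI and `MidTightN` imply the
uniform-in-family eventual bound `CarvedToSLEN`.

Proof (by contradiction).  With `R₀ := min R₀^CSI (min R₁ R₂)` (`R₁` of `eventually_productCellN`,
`R₂` of `MidTightN`), if the eventual clause of `CarvedToSLEN` fails at `(R, ρ, N)`, then
frequently as `δ → 0⁺` (together with the eventual facts `0 < δ` and "every walk lies in a product
cell") there are tame anchored families `S, T` with `P_δ(Bad) > ε`;
`Filter.exists_seq_forall_of_frequently` extracts `δ_k → 0⁺`, `S_k`, `T_k`.  For each `j`,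
`MidTightN` at `η_j := ε / 2^{j+1}` gives a compact `𝒦_j` and (transport `Tendsto.eventually`,
`eventually_atTop`) an index `K_j` from which `P_k(NotTight_j) ≤ η_j`.  At step `k`, with
`J(k) := {j ≤ k | K_j ≤ k}`, `Σ_{j ∈ J(k)} P_k(NotTight_j) ≤ Σ_{j ≤ k} η_j ≤ ε < P_k(Bad)`, so some
walk `γ_k ∈ Bad ∖ ⋃_{j ∈ J(k)} NotTight_j` exists (`SeqReduction.exists_seq_mem_diff`).  Its bad
label `(n_k; q_k)`, `(n'_k; q'_k)` is realised (by `γ_k`) with a wide link and is `ε`-bad for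
every `k`; the carved law is a probability measure
(`SeqReduction.isProbabilityMeasure_carvedLaw_of_isFirstGoodGateN`: `γ_k` lies in the cylinder of
its label, whose weight factorises by `GateDecomposition` (`measure_cyl`), so the carved weight is
nonzero; finite by `finite_hexDomainSAW`); and for `k ≥ max j K_j`, `γ_k ∉ NotTight_j` gives
`carvedLaw_k(curve ∉ 𝒦_j) ≤ η_j` — the tightness hypothesis of CSI.  CSI then yields
`∀ᶠ k, |∫ f∘curve d(carvedLaw_k) − ∫ f dν| ≤ ε`, contradicting `ε < |…|` for every `k`.
-/

noncomputable section

open scoped BigOperators Topology NNReal ENNReal Classical BoundedContinuousFunction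
open Filter Set MeasureTheory Metric

namespace Summit.CriticalPhenomena.SAWScalingLimit.Theorems.ObservableToSLER.NestedGate

open Literature.Probability.LatticeModels (HexVertex hexGraph hexCenter triZeta Site)
open Literature.Probability.RandomPlanarGeometry
open Literature.Probability.RandomPlanarGeometry.SAW
open Summit.CriticalPhenomena.SAWScalingLimit.Theorems.ObservableToSLE.Negative
  (finite_hexDomainSAW)
open Summit.CriticalPhenomena.SAWScalingLimit.Theorems.ObservableToSLER.BridgeGate

namespace SeqReduction

/-- Selection step at one mesh: a set of mass `> e` minus finitely many sets of total mass `≤ e`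
is nonempty. -/
theorem nonempty_diff_of_measure_lt {X : Type*} [MeasurableSpace X] (P : Measure X) {A : Set X}
    {ι : Type*} (J : Finset ι) (B : ι → Set X) {e : ℝ≥0∞}
    (hA : e < P A) (hB : ∑ j ∈ J, P (B j) ≤ e) : (A \ ⋃ j ∈ J, B j).Nonempty := by
  by_contra h
  rw [Set.not_nonempty_iff_eq_empty] at h
  have h1 : P A ≤ P (A \ ⋃ j ∈ J, B j) + P (⋃ j ∈ J, B j) :=
    (measure_mono (Set.subset_sdiff_union _ _)).trans (measure_union_le _ _)
  rw [h, measure_empty, zero_add] at h1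
  exact lt_irrefl _ (hA.trans_le (h1.trans ((measure_biUnion_finset_le J B).trans hB)))

/-- **Selection along a sequence.**  Measures `P k`, events `A k` of mass `> e`, and countably
many families of events `B j k` with `P k (B j k) ≤ η j` from the index `K j` on, where the
partial sums of `η` stay `≤ e`: there is a sequence `x k ∈ A k` avoiding, for every `j`, the event
`B j k` for all large `k` (at step `k` remove the `B j k` with `j ≤ k`, `K j ≤ k`). -/
theorem exists_seq_mem_diff {X : ℕ → Type*} [∀ k, MeasurableSpace (X k)]
    (P : ∀ k, Measure (X k)) (A : ∀ k, Set (X k)) (B : ℕ → ∀ k, Set (X k)) (K : ℕ → ℕ)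
    {e : ℝ≥0∞} {η : ℕ → ℝ≥0∞} (hA : ∀ k, e < P k (A k))
    (hB : ∀ j k, K j ≤ k → P k (B j k) ≤ η j) (hη : ∀ n, ∑ j ∈ Finset.range n, η j ≤ e) :
    ∃ x : ∀ k, X k, (∀ k, x k ∈ A k) ∧ ∀ j, ∀ᶠ k in atTop, x k ∉ B j k := by
  classical
  have hsel : ∀ k, ∃ x : X k, x ∈ A k ∧
      ∀ j ∈ (Finset.range (k + 1)).filter (fun j => K j ≤ k), x ∉ B j k := by
    intro k
    set J := (Finset.range (k + 1)).filter (fun j => K j ≤ k) with hJ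
    have hsum : ∑ j ∈ J, P k (B j k) ≤ e :=
      calc ∑ j ∈ J, P k (B j k) ≤ ∑ j ∈ J, η j :=
            Finset.sum_le_sum fun j hj => hB j k (Finset.mem_filter.1 hj).2
        _ ≤ ∑ j ∈ Finset.range (k + 1), η j :=
            Finset.sum_le_sum_of_subset (Finset.filter_subset _ _)
        _ ≤ e := hη (k + 1)
    obtain ⟨x, hxA, hxU⟩ := nonempty_diff_of_measure_lt (P k) J (fun j => B j k) (hA k) hsum
    exact ⟨x, hxA, fun j hj hx => hxU (Set.mem_iUnion₂.2 ⟨j, hj, hx⟩)⟩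
  choose x hxA hxB using hsel
  refine ⟨x, hxA, fun j => eventually_atTop.2 ⟨max j (K j), fun k hk => hxB k j ?_⟩⟩
  rw [Finset.mem_filter, Finset.mem_range]
  exact ⟨by omega, (le_max_right _ _).trans hk⟩

/-- The levels `η_j := ε / 2^{j+1}` have partial sums `≤ ε` (in `ℝ≥0∞`). -/
theorem sum_ofReal_div_two_pow_le {ε : ℝ} (hε : 0 ≤ ε) (n : ℕ) :
    ∑ j ∈ Finset.range n, ENNReal.ofReal (ε / 2 ^ (j + 1)) ≤ ENNReal.ofReal ε := by
  rw [← ENNReal.ofReal_sum_of_nonneg (fun j _ => by positivity)]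
  refine ENNReal.ofReal_le_ofReal ?_
  have h : ∑ j ∈ Finset.range n, ε / 2 ^ (j + 1) =
      ε / 2 * ∑ j ∈ Finset.range n, (1 / 2 : ℝ) ^ j := by
    rw [Finset.mul_sum]
    refine Finset.sum_congr rfl fun j _ => ?_
    rw [pow_succ, one_div, inv_pow]
    field_simp
  rw [h]
  calc ε / 2 * ∑ j ∈ Finset.range n, (1 / 2 : ℝ) ^ j ≤ ε / 2 * 2 :=
        mul_le_mul_of_nonneg_left (sum_geometric_two_le n) (by positivity)
    _ = ε := by ring

/-- The levels `η_j := ε / 2^{j+1}` get below every positive `η`. -/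
theorem exists_div_two_pow_le (ε : ℝ) {η : ℝ} (hη : 0 < η) : ∃ j : ℕ, ε / 2 ^ (j + 1) ≤ η := by
  obtain ⟨j, hj⟩ := exists_nat_gt (ε / η)
  refine ⟨j, ?_⟩
  have h2 : (j : ℝ) ≤ 2 ^ (j + 1) := by
    have h := (Nat.lt_two_pow_self (n := j)).le.trans
      (Nat.pow_le_pow_right two_pos (Nat.le_succ j))
    exact_mod_cast h
  rw [div_le_iff₀ (by positivity)]
  rw [div_lt_iff₀ hη] at hj
  nlinarith

/-- **The carved law of a realised cell is a probability measure.**  If a walk `γ` of `Ω_δ`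
(bounded `Ω`, `δ > 0`) lies in a product cell and has first good gates `(n; m, p, q)` in `S` and
`(n'; m', p', q')` in `T` (list reversed), then `carvedLaw Ω δ (S n ∪ T n') q q'` is a probability
measure: `γ` lies in the cylinder of its label, whose critical weight is `x_c^{|l₁|+|l₂|}` times
the total carved weight (`measure_cyl` under `GateDecomposition`), so the latter is nonzero; it is
finite since there are finitely many SAWs. -/
theorem isProbabilityMeasure_carvedLaw_of_isFirstGoodGateN {Ω : Set ℂ}
    (hΩ : Bornology.IsBounded Ω) {δ : ℝ} (hδ : 0 < δ) {ρ R C : ℝ} {S T : ℕ → Set HexVertex}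
    {a b : HexVertex} {γ : HexDomainSAW Ω δ a b} (hcs : γ ∈ productCellN Ω δ ρ R S T a b C)
    {n m : ℕ} {p q : HexVertex} {n' m' : ℕ} {p' q' : HexVertex}
    (h₁ : IsFirstGoodGateN Ω δ ρ R S a γ.walk.support n m p q)
    (h₂ : IsFirstGoodGateN Ω δ ρ R T b γ.walk.support.reverse n' m' p' q') :
    IsProbabilityMeasure (carvedLaw Ω δ (S n ∪ T n') q q') := by
  classical
  haveI : ∀ u v : HexVertex, Finite (HexDomainSAW Ω δ u v) :=
    fun u v => finite_hexDomainSAW hΩ hδ.ne' u v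
  let κ : GateLabel := ⟨n, m, p, q, n', m', p', q', γ.walk.support.take m,
    γ.walk.support.drop (γ.walk.support.length - m')⟩
  have hcell : γ.walk.support ∈ κ.cellN Ω δ ρ R S T a b := ⟨h₁, h₂, rfl, rfl⟩
  obtain ⟨hST, hw₁, hw₂, hpq, hqp, hlen, -, -, -⟩ := hcs n m p q n' m' p' q' h₁ h₂
  have hcyl : γ ∈ κ.cyl (S n) (T n') Ω δ a b := mem_cyl_of_mem_cellN hcell hlen
  have hGDκ : ∀ B : Set (List HexVertex),
      hexSAWWeight Ω δ a b
        {γ | ∃ mid ∈ B, mid.head? = some κ.q ∧ mid.getLast? = some κ.q' ∧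
          (∀ v ∈ mid, v ∉ S n ∧ v ∉ T n') ∧ γ.walk.support = κ.l₁ ++ mid ++ κ.l₂} =
      ENNReal.ofReal (hexCriticalFugacity ^ (κ.l₁.length + κ.l₂.length)) *
        hexSAWWeight Ω δ κ.q κ.q'
          {γ | γ.walk.support ∈ B ∧ ∀ v ∈ γ.walk.support, v ∉ S n ∧ v ∉ T n'} :=
    fun B => stub_gateDecomposition Ω δ a b κ.p κ.q κ.p' κ.q' (S n) (T n') κ.l₁ κ.l₂ B hST
      hw₁ hw₂ hpq hqp
  have hmc := measure_cyl κ (S n) (T n') hGDκ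
  have hfin : carvedWeight Ω δ (S n ∪ T n') q q' Set.univ ≠ ∞ := by
    rw [carvedWeight]
    exact ne_top_of_le_ne_top (hexSAWWeight_ne_top Set.univ) (Measure.restrict_le_self _)
  have h0 : carvedWeight Ω δ (S n ∪ T n') q q' Set.univ ≠ 0 := by
    intro h0
    have h1 : hexSAWWeight Ω δ a b (κ.cyl (S n) (T n') Ω δ a b) = 0 := by
      rw [hmc]
      exact mul_eq_zero_of_right _ h0
    have h2 : hexSAWWeight Ω δ a b {γ} = 0 :=
      measure_mono_null (Set.singleton_subset_iff.2 hcyl) h1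
    rw [hexSAWWeight_singleton] at h2
    exact (ENNReal.ofReal_pos.2 (pow_pos hexCriticalFugacity_pos_lt_one.1 _)).ne' h2
  exact ⟨by rw [carvedLaw, Measure.smul_apply, smul_eq_mul, ENNReal.inv_mul_cancel h0 hfin]⟩

end SeqReduction

open SeqReduction

/-- **STUB 5c of the line `bridge-gate-renewal` (reshape r5) — THE SEQUENTIAL REDUCTION
`CarvedSeqIdentification → MidTightN → CarvedToSLEN`.**  The carved sequential identification
(cell-wise along a sequence of meshes, tightness given) and the averaged tightness of the carved
middle pieces imply the uniform-in-family eventual bound `CarvedToSLEN`: by contradiction, a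
failing `(R, ρ, N)` yields meshes `δ_k → 0⁺` and tame anchored families `S_k, T_k` with
`P_k(Bad) > ε`; removing at step `k` the non-tight events of the levels `j ≤ k` active from
`K_j ≤ k` (total mass `≤ Σ ε/2^{j+1} ≤ ε`) leaves a bad walk `γ_k`, whose label is realised with a
wide link, `ε`-bad, carries a probability carved law, and is tight at every level eventually; CSI
then bounds the carved `f`-integral by `ε` eventually — contradiction. -/
theorem stub_seqReduction :
    (∀ (D : DobrushinDomain) (a b : ℝ → HexVertex), IsEmbEndpointApprox hexGraph hexCenter D a b →
       ∀ (ν : Measure (CurveClass ℂ)), IsSLELaw ((8 : ℝ≥0) / 3) D ν →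
       ∀ (f : CurveClass ℂ →ᵇ ℝ) (ε : ℝ), 0 < ε →
         ∃ R₀ > (0 : ℝ), ∀ R ∈ Set.Ioc (0 : ℝ) R₀, ∀ ρ > (0 : ℝ), ∀ N : ℕ,
           ∀ (δ : ℕ → ℝ) (S T : ℕ → ℕ → Set HexVertex) (n n' : ℕ → ℕ) (q q' : ℕ → HexVertex),
             Tendsto δ atTop (𝓝[>] 0) →
             (∀ k, TameNestedFamily (δ k) R N (a (δ k)) (S k) ∧
               TameNestedFamily (δ k) R N (b (δ k)) (T k) ∧
               (∀ i, ExteriorAnchored D.carrier (δ k) (S k i) (a (δ k))) ∧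
               (∀ i, ExteriorAnchored D.carrier (δ k) (T k i) (b (δ k)))) →
             (∀ k, ∃ (γ : HexDomainSAW D.carrier (δ k) (a (δ k)) (b (δ k))) (m : ℕ) (p : HexVertex)
                 (m' : ℕ) (p' : HexVertex),
               IsFirstGoodGateN D.carrier (δ k) ρ R (S k) (a (δ k)) γ.walk.support (n k) m p (q k) ∧
               IsFirstGoodGateN D.carrier (δ k) ρ R (T k) (b (δ k)) γ.walk.support.reverse
                 (n' k) m' p' (q' k) ∧
               WideLink D.carrier (δ k) ρ (S k (n k) ∪ T k (n' k)) (q k) (q' k)) →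
             (∀ k, IsProbabilityMeasure
               (carvedLaw D.carrier (δ k) (S k (n k) ∪ T k (n' k)) (q k) (q' k))) →
             (∀ η > (0 : ℝ), ∃ 𝒦 : Set (CurveClass ℂ), IsCompact 𝒦 ∧ ∀ᶠ k in atTop,
               carvedLaw D.carrier (δ k) (S k (n k) ∪ T k (n' k)) (q k) (q' k)
                 {ξ | ξ.curve ∉ 𝒦} ≤ ENNReal.ofReal η) →
             ∀ᶠ k in atTop,
               |(∫ ξ, f ξ.curve ∂(carvedLaw D.carrier (δ k) (S k (n k) ∪ T k (n' k)) (q k) (q' k))) -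
                   ∫ x, f x ∂ν| ≤ ε) →
    (∀ (D : DobrushinDomain) (a b : ℝ → HexVertex), IsEmbEndpointApprox hexGraph hexCenter D a b →
       ∃ R₂ > (0 : ℝ), ∀ R ∈ Set.Ioc (0 : ℝ) R₂, ∀ ρ > (0 : ℝ), ∀ N : ℕ, ∀ η > (0 : ℝ),
         ∃ 𝒦 : Set (CurveClass ℂ), IsCompact 𝒦 ∧
           ∀ᶠ δ : ℝ in 𝓝[>] 0, ∀ S T : ℕ → Set HexVertex,
             TameNestedFamily δ R N (a δ) S → TameNestedFamily δ R N (b δ) T →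
             hexSAWLaw D.carrier δ (a δ) (b δ)
               {γ | ∃ (n m : ℕ) (p q : HexVertex) (n' m' : ℕ) (p' q' : HexVertex),
                   IsFirstGoodGateN D.carrier δ ρ R S (a δ) γ.walk.support n m p q ∧
                   IsFirstGoodGateN D.carrier δ ρ R T (b δ) γ.walk.support.reverse n' m' p' q' ∧
                   ENNReal.ofReal η <
                     carvedLaw D.carrier δ (S n ∪ T n') q q' {ξ | ξ.curve ∉ 𝒦}} ≤
               ENNReal.ofReal η) →
    ∀ (D : DobrushinDomain) (a b : ℝ → HexVertex), IsEmbEndpointApprox hexGraph hexCenter D a b →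
      ∀ (ν : Measure (CurveClass ℂ)), IsSLELaw ((8 : ℝ≥0) / 3) D ν →
      ∀ (f : CurveClass ℂ →ᵇ ℝ) (ε : ℝ), 0 < ε →
        ∃ R₀ > (0 : ℝ), ∀ R ∈ Set.Ioc (0 : ℝ) R₀, ∀ ρ > (0 : ℝ), ∀ N : ℕ,
          ∀ᶠ δ : ℝ in 𝓝[>] 0, ∀ S T : ℕ → Set HexVertex,
            TameNestedFamily δ R N (a δ) S → TameNestedFamily δ R N (b δ) T →
            (∀ n, ExteriorAnchored D.carrier δ (S n) (a δ)) →
            (∀ n, ExteriorAnchored D.carrier δ (T n) (b δ)) →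
            hexSAWLaw D.carrier δ (a δ) (b δ)
              {γ | ∃ (n m : ℕ) (p q : HexVertex) (n' m' : ℕ) (p' q' : HexVertex),
                  IsFirstGoodGateN D.carrier δ ρ R S (a δ) γ.walk.support n m p q ∧
                  IsFirstGoodGateN D.carrier δ ρ R T (b δ) γ.walk.support.reverse n' m' p' q' ∧
                  WideLink D.carrier δ ρ (S n ∪ T n') q q' ∧
                  ε < |(∫ ξ, f ξ.curve ∂(carvedLaw D.carrier δ (S n ∪ T n') q q')) - ∫ x, f x ∂ν|} ≤
              ENNReal.ofReal ε := by
  intro hCSI hMT D a b hab ν hν f ε hε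
  obtain ⟨R₀', hR₀', hC⟩ := hCSI D a b hab ν hν f ε hε
  obtain ⟨R₁, hR₁, hcells⟩ := eventually_productCellN D a b hab
  obtain ⟨R₂, hR₂, hM⟩ := hMT D a b hab
  refine ⟨min R₀' (min R₁ R₂), lt_min hR₀' (lt_min hR₁ hR₂), ?_⟩
  rintro R ⟨hR0, hRle⟩ ρ hρ N
  have hRR₀' : R ∈ Set.Ioc 0 R₀' := ⟨hR0, hRle.trans (min_le_left _ _)⟩
  have hRR₁ : R ∈ Set.Ioc 0 R₁ := ⟨hR0, hRle.trans ((min_le_right _ _).trans (min_le_left _ _))⟩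
  have hRR₂ : R ∈ Set.Ioc 0 R₂ := ⟨hR0, hRle.trans ((min_le_right _ _).trans (min_le_right _ _))⟩
  by_contra hnot
  -- STEP 1: a sequence of meshes `δ_k → 0⁺` with product cells and bad tame anchored families
  have hev : ∀ᶠ δ : ℝ in 𝓝[>] 0, 0 < δ ∧ ∀ S T : ℕ → Set HexVertex,
      TameNestedFamily δ R N (a δ) S → TameNestedFamily δ R N (b δ) T →
        ∀ γ₀ : HexDomainSAW D.carrier δ (a δ) (b δ),
          γ₀ ∈ productCellN D.carrier δ ρ R S T (a δ) (b δ) (3 * R) := by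
    filter_upwards [self_mem_nhdsWithin, hcells R hRR₁ ρ N] with δ hδ hc
    exact ⟨hδ, hc⟩
  obtain ⟨δs, hδs, hk⟩ :=
    exists_seq_forall_of_frequently ((not_eventually.1 hnot).and_eventually hev)
  have hk' : ∀ k, ∃ S T : ℕ → Set HexVertex, TameNestedFamily (δs k) R N (a (δs k)) S ∧
      TameNestedFamily (δs k) R N (b (δs k)) T ∧
      (∀ i, ExteriorAnchored D.carrier (δs k) (S i) (a (δs k))) ∧
      (∀ i, ExteriorAnchored D.carrier (δs k) (T i) (b (δs k))) ∧
      ENNReal.ofReal ε < hexSAWLaw D.carrier (δs k) (a (δs k)) (b (δs k))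
        {γ | ∃ (n m : ℕ) (p q : HexVertex) (n' m' : ℕ) (p' q' : HexVertex),
            IsFirstGoodGateN D.carrier (δs k) ρ R S (a (δs k)) γ.walk.support n m p q ∧
            IsFirstGoodGateN D.carrier (δs k) ρ R T (b (δs k)) γ.walk.support.reverse
              n' m' p' q' ∧
            WideLink D.carrier (δs k) ρ (S n ∪ T n') q q' ∧
            ε < |(∫ ξ, f ξ.curve ∂(carvedLaw D.carrier (δs k) (S n ∪ T n') q q')) -
              ∫ x, f x ∂ν|} := by
    intro k
    have h := (hk k).1
    push Not at h
    obtain ⟨S, T, hS, hT, hAS, hAT, hlt⟩ := h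
    exact ⟨S, T, hS, hT, hAS, hAT, hlt⟩
  choose S T hS hT hAS hAT hbad using hk'
  -- STEP 2: the averaged tightness at the levels `η_j := ε / 2^(j+1)`, from an index `K_j` on
  obtain ⟨ηs, hηs⟩ : ∃ ηs : ℕ → ℝ, ∀ j, ηs j = ε / 2 ^ (j + 1) := ⟨_, fun j => rfl⟩
  have hηpos : ∀ j, 0 < ηs j := fun j => by rw [hηs]; positivity
  have hj : ∀ j : ℕ, ∃ 𝒦 : Set (CurveClass ℂ), IsCompact 𝒦 ∧ ∃ Kj : ℕ, ∀ k ≥ Kj,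
      ∀ S T : ℕ → Set HexVertex, TameNestedFamily (δs k) R N (a (δs k)) S →
        TameNestedFamily (δs k) R N (b (δs k)) T →
        hexSAWLaw D.carrier (δs k) (a (δs k)) (b (δs k))
          {γ | ∃ (n m : ℕ) (p q : HexVertex) (n' m' : ℕ) (p' q' : HexVertex),
              IsFirstGoodGateN D.carrier (δs k) ρ R S (a (δs k)) γ.walk.support n m p q ∧
              IsFirstGoodGateN D.carrier (δs k) ρ R T (b (δs k)) γ.walk.support.reverse
                n' m' p' q' ∧
              ENNReal.ofReal (ηs j) <
                carvedLaw D.carrier (δs k) (S n ∪ T n') q q' {ξ | ξ.curve ∉ 𝒦}} ≤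
          ENNReal.ofReal (ηs j) := by
    intro j
    obtain ⟨𝒦, h𝒦, hevj⟩ := hM R hRR₂ ρ hρ N (ηs j) (hηpos j)
    exact ⟨𝒦, h𝒦, eventually_atTop.1 (hδs.eventually hevj)⟩
  choose 𝒦 h𝒦 K hK using hj
  -- STEP 3: selection of a bad walk, tight at every active level
  obtain ⟨γ, hγA, hγB⟩ := exists_seq_mem_diff
    (fun k => hexSAWLaw D.carrier (δs k) (a (δs k)) (b (δs k)))
    (fun k => {γ | ∃ (n m : ℕ) (p q : HexVertex) (n' m' : ℕ) (p' q' : HexVertex),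
      IsFirstGoodGateN D.carrier (δs k) ρ R (S k) (a (δs k)) γ.walk.support n m p q ∧
      IsFirstGoodGateN D.carrier (δs k) ρ R (T k) (b (δs k)) γ.walk.support.reverse
        n' m' p' q' ∧
      WideLink D.carrier (δs k) ρ (S k n ∪ T k n') q q' ∧
      ε < |(∫ ξ, f ξ.curve ∂(carvedLaw D.carrier (δs k) (S k n ∪ T k n') q q')) -
        ∫ x, f x ∂ν|})
    (fun j k => {γ | ∃ (n m : ℕ) (p q : HexVertex) (n' m' : ℕ) (p' q' : HexVertex),
      IsFirstGoodGateN D.carrier (δs k) ρ R (S k) (a (δs k)) γ.walk.support n m p q ∧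
      IsFirstGoodGateN D.carrier (δs k) ρ R (T k) (b (δs k)) γ.walk.support.reverse
        n' m' p' q' ∧
      ENNReal.ofReal (ηs j) <
        carvedLaw D.carrier (δs k) (S k n ∪ T k n') q q' {ξ | ξ.curve ∉ 𝒦 j}})
    K hbad (fun j k hjk => hK j k hjk (S k) (T k) (hS k) (hT k))
    (fun n' => by simp_rw [hηs]; exact sum_ofReal_div_two_pow_le hε.le n')
  have hγA' : ∀ k, ∃ (n m : ℕ) (p q : HexVertex) (n' m' : ℕ) (p' q' : HexVertex),
      IsFirstGoodGateN D.carrier (δs k) ρ R (S k) (a (δs k)) (γ k).walk.support n m p q ∧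
      IsFirstGoodGateN D.carrier (δs k) ρ R (T k) (b (δs k)) (γ k).walk.support.reverse
        n' m' p' q' ∧
      WideLink D.carrier (δs k) ρ (S k n ∪ T k n') q q' ∧
      ε < |(∫ ξ, f ξ.curve ∂(carvedLaw D.carrier (δs k) (S k n ∪ T k n') q q')) -
        ∫ x, f x ∂ν| := fun k => hγA k
  choose n m p q n' m' p' q' hFG hFG' hWL hεlt using hγA'
  -- STEP 4: the hypotheses of CSI along the selected labels
  have hprob : ∀ k, IsProbabilityMeasure
      (carvedLaw D.carrier (δs k) (S k (n k) ∪ T k (n' k)) (q k) (q' k)) := fun k =>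
    isProbabilityMeasure_carvedLaw_of_isFirstGoodGateN D.isBounded (hk k).2.1
      ((hk k).2.2 (S k) (T k) (hS k) (hT k) (γ k)) (hFG k) (hFG' k)
  have htight : ∀ η > (0 : ℝ), ∃ 𝒦' : Set (CurveClass ℂ), IsCompact 𝒦' ∧ ∀ᶠ k in atTop,
      carvedLaw D.carrier (δs k) (S k (n k) ∪ T k (n' k)) (q k) (q' k)
        {ξ | ξ.curve ∉ 𝒦'} ≤ ENNReal.ofReal η := by
    intro η hη
    obtain ⟨j, hjη⟩ := exists_div_two_pow_le ε hη
    rw [← hηs] at hjη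
    refine ⟨𝒦 j, h𝒦 j, (hγB j).mono fun k hk => ?_⟩
    simp only [Set.mem_setOf_eq, not_exists, not_and, not_lt] at hk
    exact (hk _ _ _ _ _ _ _ _ (hFG k) (hFG' k)).trans (ENNReal.ofReal_le_ofReal hjη)
  -- STEP 5: CSI bounds the carved integrals eventually; contradiction with badness
  have hconc := hC R hRR₀' ρ hρ N δs S T n n' q q' hδs (fun k => ⟨hS k, hT k, hAS k, hAT k⟩)
    (fun k => ⟨γ k, m k, p k, m' k, p' k, hFG k, hFG' k, hWL k⟩) hprob htight
  obtain ⟨k, hk⟩ := hconc.exists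
  exact (not_lt.2 hk) (hεlt k)

end Summit.CriticalPhenomena.SAWScalingLimit.Theorems.ObservableToSLER.NestedGate

end
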